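import Literature.AnabelianGeometry.SemiGraphs.TemperedPiChartVirtuallyFreeTower
import Literature.AnabelianGeometry.SemiGraphs.GaloisLevelDataChart
import Literature.AnabelianGeometry.SemiGraphs.GaloisLevelDataOfSeq
import HarnessLib

/-!
# The virtually free tower from ANY cofinal Galois tower, for every chart ([SemiAnbd] Prop. 3.6 p. 38)

Mochizuki, *Semi-graphs of anabelioids*, Publ. RIMS **42** (2006) [SemiAnbd], §3 p. 38: "Let
`{𝒢_i → 𝒢}_{i ∈ I}` be some cofinal collection of connected finite étale Galois coverings …
`π₁^temp(𝒢) := lim Gal(𝒢_{∞,i}/𝒢)` … independent, up to inner automorphism, of the choice of the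
cofinal system."  [cite: MochizukiSemiAnbd2006, Prop 3.6 p.38]

PROOF-ONLY file (abc-iut cell, prover abc-iut-w5-d139; no definitions).  `TemperedPiVirtuallyFreeTower`
proves the André tower property `htower₀` for `D.temperedPi` of ANY Galois level data `D` (generic
hypotheses: fibre-rigid endomorphisms, finite base fibres, free deck groups of finite rank, ONE level with
non-abelian deck group), and `TemperedPiChartVirtuallyFreeTower` transports it to every chart through
the FIXED enumeration `𝒢.galoisLevelData h36` — whose levels are opaque choices, so that the one residual
hypothesis (a level with non-abelian graph fundamental group) is hard to verify there.  This file removes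
that inconvenience using abc-iut-L3-t9's chart of an ARBITRARY cofinal tower
(`GaloisLevelData.chart`, `GaloisLevelDataChart.lean`) and prescribed towers
(`GaloisLevelData.ofGaloisSeq`, `GaloisLevelDataOfSeq.lean`):

* `GaloisLevelData.deckGroup_finite_rank_of_sameComponent` — for level data with CONNECTED finite
  levels over a semi-graph of anabelioids with finitely many edges, every deck group
  `π₁(𝔾_{S n}, [x_n])` is free of finite rank (the `hrank` input, discharged generically);
* `GaloisLevelData.tower_chart` — for ANY cofinal Galois level data satisfying the generic hypotheses,
  EVERY tempered fundamental group chart `c` of `𝒢` has `htower₀` (the chart of `D` is isomorphic to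
  `c`, Prop. 3.2 / `TemperedPiChart.exists_compatIso`);
* `TemperedPiChart.tower_ofGaloisSeq` — the PRESCRIBED-TOWER form: for a sequence of connected Galois
  objects `A n` of `B(𝒢)` with transition morphisms, cofinal, ONE of whose levels has a non-abelian
  graph fundamental group `π₁(𝔾_{A n}, [x_n])`, every chart has `htower₀`; rigidity, finiteness and
  finite rank of the levels are theorems (`hrigid_ofBObj_of_isConnected`, `ofBObj_isFinite`,
  `sameComponent_ofBObj_of_isConnected`).  So the residual hypothesis can be checked on a tower chosen
  by the consumer (e.g. one where a level with first Betti number `≥ 2` is explicit).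

Nothing here concerns the disputed parts of inter-universal Teichmüller theory or takes a side on
[IUTchIII] Cor. 3.12.
-/

noncomputable section

namespace Literature.AnabelianGeometry.SemiGraphs

namespace ProfiniteSemiGraph

open CategoryTheory
open _root_.Topology
open Literature.GroupTheory.CombinatorialGroupTheory

universe u

variable {𝒢 : ProfiniteSemiGraph.{u}}

namespace GaloisLevelData

variable (D : GaloisLevelData 𝒢)

/-- In a level whose points all lie in ONE component, every component of the graph `𝔾_{S n}` is
reachable from the base component `[x_n]` in the fundamental groupoid.
[cite: MochizukiSemiAnbd2006, Prop 3.6 p.38] -/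
theorem nonempty_hom_baseComp_of_sameComponent (n : ℕ)
    (hconn : ∀ p q : (D.S n).Point, (D.S n).SameComponent p q)
    (a : (D.S n).orbitGraph.CatCarrier) :
    Nonempty ((D.S n).orbitGraph.basept ((D.S n).baseComp D.v₀ (D.x n)) ⟶
      (D.S n).orbitGraph.basept a) := by
  have hnode : ∃ q : (D.S n).Point, (D.S n).pointNode q = a := by
    rcases a with V | E
    · obtain ⟨x, hx⟩ := CovObj.OVertex.exists_rep (D.S n) V
      exact ⟨Sum.inl ⟨_, x⟩, congrArg Sum.inl hx⟩
    · obtain ⟨y, hy⟩ := CovObj.OEdge.exists_rep (D.S n) E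
      exact ⟨Sum.inr ⟨_, y⟩, congrArg Sum.inr hy⟩
  obtain ⟨q, rfl⟩ := hnode
  exact (D.S n).nonempty_hom_of_sameComponent (hconn (Sum.inl ⟨D.v₀, D.x n⟩) q)

/-- **The deck groups `π₁(𝔾_{S n}, [x_n])` of Galois level data with CONNECTED FINITE levels, over a
semi-graph of anabelioids with finitely many edges, are free of finite rank** (the input `hrank` of
`temperedPi_tower`, discharged generically). [cite: MochizukiSemiAnbd2006, Prop 3.6 p.38] -/
theorem deckGroup_finite_rank_of_sameComponent [Finite 𝒢.graph.Edge]
    (hfinS : ∀ n, (D.S n).IsFinite)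
    (hconn : ∀ n (p q : (D.S n).Point), (D.S n).SameComponent p q) (n : ℕ) :
    ∃ _ : IsFreeGroup ((D.S n).orbitGraph.FundamentalGroup ((D.S n).baseComp D.v₀ (D.x n))),
      Finite (IsFreeGroup.Generators
        ((D.S n).orbitGraph.FundamentalGroup ((D.S n).baseComp D.v₀ (D.x n)))) := by
  haveI : Finite (D.S n).orbitGraph.Branch := CovObj.finite_orbitGraph_branch _ (hfinS n)
  exact SemiGraph.exists_isFreeGroup_finite_generators_fundamentalGroup _ _
    (D.nonempty_hom_baseComp_of_sameComponent n (hconn n))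

/-- **The virtually free tower for EVERY chart, from ANY cofinal Galois level data.**  Let `D` be
Galois level data of a connected countable `𝒢` whose levels are cofinal (`hcof`), split themselves,
are finite with nonempty fibres (the inputs of abc-iut-L3-t9's `GaloisLevelData.chart`), have
fibre-rigid endomorphisms, free deck groups of finite rank, and a non-abelian deck group at SOME level.
Then the group of every tempered fundamental group chart `c` of `𝒢` satisfies `htower₀` (transport
from `D.temperedPi = (D.chart …).G` along Prop. 3.2, `TemperedPiChart.exists_compatIso`).
[cite: MochizukiSemiAnbd2006, Prop 3.6 p.38] -/
theorem tower_chart (h𝒢 : 𝒢.IsCountable) (hc : 𝒢.graph.IsConnected)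
    (hcof : ∀ (T : CovObj 𝒢), T.IsTempered → ∀ p : T.Point,
      ∃ i : ℕ, ∀ j, i ≤ j → (D.S j).Splits (T.component p))
    (hS : ∀ n, (D.S n).Splits (D.S n)) (hfinS : ∀ n, (D.S n).IsFinite)
    (hne : ∀ n, (D.S n).HasNonemptyFibres)
    (hrigid : ∀ n (σ σ' : D.S n ⟶ D.S n),
      (σ.fV D.v₀).hom.hom (D.x n) = (σ'.fV D.v₀).hom.hom (D.x n) → σ = σ')
    (hrank : ∀ n, ∃ _ : IsFreeGroup ((D.S n).orbitGraph.FundamentalGroup ((D.S n).baseComp D.v₀ (D.x n))),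
      Finite (IsFreeGroup.Generators ((D.S n).orbitGraph.FundamentalGroup ((D.S n).baseComp D.v₀ (D.x n)))))
    (hnonab : ∃ (n₁ : ℕ) (a b : (D.S n₁).orbitGraph.FundamentalGroup ((D.S n₁).baseComp D.v₀ (D.x n₁))),
      a * b ≠ b * a)
    (c : TemperedPiChart 𝒢) :
    ∀ U ∈ 𝓝 (1 : c.G), ∃ N : OpenNormalSubgroup c.G, (N : Set c.G) ⊆ U ∧
      ∃ (G : Subgroup (c.G ⧸ N.toSubgroup)) (_ : IsFreeGroup G), G.Normal ∧ G.FiniteIndex ∧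
        Finite (IsFreeGroup.Generators G) ∧ ∃ a ∈ G, ∃ b ∈ G, a * b ≠ b * a := by
  obtain ⟨φ, ψ, hψφ, hφψ, -, -⟩ :=
    TemperedPiChart.exists_compatIso (D.chart h𝒢 hcof hc hS hfinS hne) c
  let e : D.temperedPi h𝒢 ≃ₜ* c.G :=
    ⟨⟨⟨φ, ψ, hψφ, hφψ⟩, fun x y => map_mul φ x y⟩, φ.continuous, ψ.continuous⟩
  exact tower_of_continuousMulEquiv e
    (D.temperedPi_tower_of_exists h𝒢 hrigid (fun n => (hfinS n).finite_V D.v₀) hrank hnonab)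

end GaloisLevelData

/-! ### The prescribed-tower form -/

/-- **The virtually free tower for every chart, from a PRESCRIBED cofinal tower of Galois objects.**
Let `𝒢` be connected and countable with finitely many edges, `A n` a sequence of connected Galois
objects of `B(𝒢)` with transition morphisms `f n : A (n+1) ⟶ A n`, cofinal (`hcof`, e.g. by
`ofGaloisSeq_exists_level_splits_component(_of_dominates)`), such that the graph fundamental group
`π₁(𝔾_{A n}, [x_n])` of ONE level is non-abelian.  Then the group of every tempered fundamental group
chart of `𝒢` has the tower property `htower₀`; rigidity (`hrigid_ofBObj_of_isConnected`), finiteness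
(`ofBObj_isFinite`) and finite rank of the levels (connectedness `sameComponent_ofBObj_of_isConnected`
+ `deckGroup_finite_rank_of_sameComponent`) are THEOREMS. [cite: MochizukiSemiAnbd2006, Prop 3.6 p.38] -/
theorem TemperedPiChart.tower_ofGaloisSeq (hc : 𝒢.graph.IsConnected) (h𝒢 : 𝒢.IsCountable)
    [Finite 𝒢.graph.Edge] (v₀ : 𝒢.graph.Vertex) (A : ℕ → 𝒢.toAnab.BObj)
    (hA : ∀ n, letI := SemiGraphOfAnabelioids.galoisCategory_bObj 𝒢.toAnab ⟨hc⟩;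
      PreGaloisCategory.IsGalois (A n))
    (f : ∀ n, A (n + 1) ⟶ A n)
    (hcof : ∀ (T : CovObj 𝒢), T.IsTempered → ∀ p : T.Point, ∃ i : ℕ, ∀ j, i ≤ j →
      ((GaloisLevelData.ofGaloisSeq 𝒢 hc v₀ A hA f).S j).Splits (T.component p))
    (hnonab : ∃ (n : ℕ) (a b : ((GaloisLevelData.ofGaloisSeq 𝒢 hc v₀ A hA f).S n).orbitGraph.FundamentalGroup
      (((GaloisLevelData.ofGaloisSeq 𝒢 hc v₀ A hA f).S n).baseComp v₀
        ((GaloisLevelData.ofGaloisSeq 𝒢 hc v₀ A hA f).x n))), a * b ≠ b * a)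
    (c : TemperedPiChart 𝒢) :
    ∀ U ∈ 𝓝 (1 : c.G), ∃ N : OpenNormalSubgroup c.G, (N : Set c.G) ⊆ U ∧
      ∃ (G : Subgroup (c.G ⧸ N.toSubgroup)) (_ : IsFreeGroup G), G.Normal ∧ G.FiniteIndex ∧
        Finite (IsFreeGroup.Generators G) ∧ ∃ a ∈ G, ∃ b ∈ G, a * b ≠ b * a := by
  letI := SemiGraphOfAnabelioids.galoisCategory_bObj 𝒢.toAnab ⟨hc⟩
  let D := GaloisLevelData.ofGaloisSeq 𝒢 hc v₀ A hA f
  have hconn : ∀ n (p q : (D.S n).Point), (D.S n).SameComponent p q := fun n p q =>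
    𝒢.sameComponent_ofBObj_of_isConnected hc (A n) (hA n).toIsConnected p q
  exact D.tower_chart h𝒢 hc hcof (GaloisLevelData.ofGaloisSeq_splits_self 𝒢 hc v₀ A hA f)
    (GaloisLevelData.ofGaloisSeq_isFinite 𝒢 hc v₀ A hA f)
    (GaloisLevelData.ofGaloisSeq_hasNonemptyFibres 𝒢 hc v₀ A hA f)
    (fun n σ σ' h => 𝒢.hrigid_ofBObj_of_isConnected hc (A n) (hA n).toIsConnected _ _ σ σ' h)
    (D.deckGroup_finite_rank_of_sameComponent (GaloisLevelData.ofGaloisSeq_isFinite 𝒢 hc v₀ A hA f)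
      hconn)
    hnonab c

end ProfiniteSemiGraph

end Literature.AnabelianGeometry.SemiGraphs

end
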